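import Summits.ResolutionOfSingularities.ResolutionOfSingularities.Theses.WildCones
import Summits.ResolutionOfSingularities.ResolutionOfSingularities.Theorems.NoPeriodicIsolatedAtom.Negative.FalseWithoutIsol

/-!
# `ClassicalRegimes` (crux stmt-ResolutionOfSingularities-16884, route `WildCones`):
# the isolatedness conjunct `Isol` is load-bearing — WITHOUT it the statement is FALSE
# (negative-side support from the crux-disprover seat; this file does NOT refute the crux)

The crux says: for a prime `p`, `0 < n`, in the classical regimes `n ≤ 2 ∨ p = 2`, over every
perfect field `κ` of characteristic `p`, NO start `c₀`, chart word `i` and translation word `t` make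
every state of the point-blow-up dynamics of the height-one atom `z^p = a(u_1, …, u_n)` ISOLATED
(`Isol`: `κ[[u]]/(∂a)` finite over `κ`) of MULTIPLICITY `p` (`MultP`: cleaned state non-zero of
order `≥ p`).

The dynamics is the SAME thirteen-operator `let`-calculus as FrobeniusClosing's
`NoPeriodicIsolatedAtom` (verbatim), whose operators are already mirrored as `def`s in
`Theorems/NoPeriodicIsolatedAtom/Negative/FalseWithoutIsol.lean`; we import them, certify by
`crux_iff : ClassicalRegimes ↔ … := Iff.rfl` that the mirror is EXACT for this crux too, and record,
sorry-free, that the isolatedness conjunct cannot be dropped: the Whitney umbrella `z² = x²y` over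
`𝔽₂` (`p = 2`, `n = 2` — inside BOTH classical regimes) is a literal fixed point of the chart-`y` step
at translation `0` (`x²y ↦ x²y³ ↦ x²y³/y² = x²y`), of multiplicity `2` at every stage (and singular
along the `y`-axis, so not isolated). Hence the `Isol`-free version of `ClassicalRegimes` fails at
`(p, n, κ) = (2, 2, 𝔽₂)`: eternal NON-isolated multiplicity-`p` runs are cheap (Hauser–Perlega's
remark that cycles are easy once the centre is not forced), and every proof of the crux — Lipman's
finiteness for `n = 2`, the Morse/suspension descent for `p = 2` — must use `Isol` at infinitely many
stages (see also `FalseWithoutMultP.lean` in this directory for the other run conjunct and the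
primality binder).
-/

noncomputable section

-- single-problem summit: the doubled namespace component `ResolutionOfSingularities` is forced by the tree layout
set_option linter.dupNamespace false

namespace Summit.ResolutionOfSingularities.ResolutionOfSingularities.Theorems.ClassicalRegimes.Negative

open Summit.ResolutionOfSingularities.ResolutionOfSingularities.Theses.WildCones (ClassicalRegimes)
open Summit.ResolutionOfSingularities.ResolutionOfSingularities.Theorems.NoPeriodicIsolatedAtom.Negative
  (clean run jac umbrella run_umbrella multP_umbrella)
open scoped BigOperators Classical

/-- **The mirror is exact for `ClassicalRegimes`**: the route decl is, definitionally, the following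
proposition over the mirrored operators `clean`, `run`, `jac` of
`Theorems/NoPeriodicIsolatedAtom/Negative/FalseWithoutIsol.lean` (its `let`-block ζ-reduces onto
those `def`s; the two run predicates `Isol`, `MultP` are displayed inline). [folklore] -/
theorem crux_iff :
    ClassicalRegimes ↔
      ∀ p : ℕ, p.Prime → ∀ n : ℕ, 0 < n → (n ≤ 2 ∨ p = 2) → ∀ (κ : Type) [Field κ] [CharP κ p] [PerfectField κ]
        (c₀ : (Fin n → ℕ) → κ) (i : ℕ → Fin n) (t : ℕ → Fin n → κ),
        ¬ (∀ m, Module.Finite κ (MvPowerSeries (Fin n) κ ⧸ jac p (run p c₀ i t m)) ∧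
          ((∃ A, clean p (run p c₀ i t m) A ≠ 0) ∧
            ∀ A, clean p (run p c₀ i t m) A ≠ 0 → p ≤ Finset.sum Finset.univ (fun j => A j))) :=
  Iff.rfl

/-- **`Isol` is load-bearing in `ClassicalRegimes`.** The proposition below is the right-hand side
of `crux_iff` with the isolatedness conjunct `Module.Finite κ (κ[[u]] ⧸ jac …)` deleted and nothing
else changed; it is false: at `p = 2`, `n = 2` (both classical regimes at once), over the perfect
field `𝔽₂`, the Whitney umbrella `z² = x²y` runs for ever along the constant chart word `y` with zero
translations, with multiplicity `2` at every stage (`run_umbrella`, `multP_umbrella`). So no argument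
that ignores isolatedness — in particular no pure multiplicity / order bookkeeping — can prove the
crux. [cite: HauserPerlega2019, §1 p. 3 (cycles are easy once the choice of centres is not forced)] -/
theorem classicalRegimes_false_without_Isol :
    ¬ ∀ p : ℕ, p.Prime → ∀ n : ℕ, 0 < n → (n ≤ 2 ∨ p = 2) → ∀ (κ : Type) [Field κ] [CharP κ p] [PerfectField κ]
        (c₀ : (Fin n → ℕ) → κ) (i : ℕ → Fin n) (t : ℕ → Fin n → κ),
        ¬ (∀ m, ((∃ A, clean p (run p c₀ i t m) A ≠ 0) ∧
            ∀ A, clean p (run p c₀ i t m) A ≠ 0 → p ≤ Finset.sum Finset.univ (fun j => A j))) := by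
  intro h
  haveI : PerfectField (ZMod 2) := PerfectField.ofFinite
  exact h 2 Nat.prime_two 2 two_pos (Or.inl le_rfl) (ZMod 2) umbrella (fun _ => 1) (fun _ _ => 0)
    (fun m => by rw [run_umbrella]; exact multP_umbrella)

end Summit.ResolutionOfSingularities.ResolutionOfSingularities.Theorems.ClassicalRegimes.Negative

end
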